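import Summits.Ventures.YMGap.Thresholds.CouplingDerivative
import Summits.Ventures.YMGap.Thresholds.CouplingDerivativeSUN
import Summits.Ventures.YMGap.Thresholds.CouplingDerivativeDim
import Summits.Ventures.YMGap.RobustBall.UniformLoopCorrelatorDecay
import HarnessLib

/-!
# Venture YMGap — C-DIFF / C-LIP-STAR FOR WILSON LOOPS: every Wilson-loop expectation of the strong-coupling state is
# Lipschitz and `C¹` in the coupling, with derivative the loop–plaquette response series

HONEST FRAMING: venture file of the cell `pub-ymgap` (QuantumFields programme), seat ds-1; corollaries of this seat's
`CouplingDerivative` / `CouplingDerivativeSUN` / `CouplingDerivativeDim` for the observables of the cell's area-law and FLOW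
rows — the Wilson loop `W_γ = (1/N) Re tr U_γ` of ANY closed lattice walk `γ` (rb-p1's `loopTerm N 1 γ`, a Lipschitz cylinder
on the links of `γ` by `isLipschitzCylinder_loopTerm`).  Strong-coupling LATTICE statements (one-sided star window); `C¹` in the
coupling, NOT analyticity; no area law, string tension or continuum statement is made or altered here.

* `su2_hasDerivAt_loop_9_25` — `SU(2)`, `d = 4`: `d/dβ_W ⟨W_γ⟩_{β_W} = Σ_q Cov_{β_W}(W_γ, W_q)` at every `0 < β_W < 9/25`, any DLR
  selection, every closed walk `γ` (links based within `D` of `x₀`);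
* `su2_abs_loop_sub_loop_le_9_25` — `SU(2)`, `d = 4`: `⟨W_γ⟩` is Lipschitz in `β_W` on `[0, 9/25]` (explicit constant);
* `hasDerivAt_loop_SU_thooft` — every `SU(N)`, `N ≥ 2`, `d = 4`, at `0 < b < N·9/308` (derivative `N·Σ_q Cov_b(W_γ, W_q)`);
* `hasDerivAt_loop_dim_thooft` — every `SU(N)`, `N ≥ 2`, every `d ≥ 2`, at `0 < b < N/(12(d−1))`.

References (mechanism only): B. Simon (1993) §II.1, §II.12.
-/

noncomputable section

open MeasureTheory ProbabilityTheory Set SimpleGraph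
open scoped NNReal
open Literature.Probability.LatticeModels (zdGraph)
open Literature.MathematicalPhysics.QuantumLattice (LGConfig ZdEdge ZdPlaquette fundamentalRep ymGibbsMeasures)
open Literature.MathematicalPhysics.QuantumFieldTheory hiding ZdEdge
open Literature.MathematicalPhysics.QuantumFieldTheory (walkEdges)
open Summit.Ventures.YMGap.RobustBall (loopTerm isLipschitzCylinder_loopTerm numOrient)
open Summit.Ventures.YMGap.DSWindow (starRate)
open Summit.Ventures.YMGap.StarWindowGauge (gaugeR)

namespace Summit.Ventures.YMGap.CouplingResponse

variable {d N : ℕ}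

/-- ★ **Wilson loops are `C¹` in the coupling** (`SU(2)`, `d = 4`, hypothesis-free): for any DLR selection `μ` on `[0, 9/25]`,
every closed lattice walk `γ` based at `x` with links within sup-distance `D` of `x₀`, and every `0 < β_W < 9/25`:
`d/dβ_W ⟨W_γ⟩_{μ β_W} = Σ_q Cov_{μ β_W}(W_γ, W_q)` (`W_γ = ½ Re tr U_γ`, `W_q = ½ Re tr U_q`). [folklore] -/
theorem su2_hasDerivAt_loop_9_25
    {μ : ℝ → Measure (LGConfig 4 (Matrix.specialUnitaryGroup (Fin 2) ℂ))}
    (hμ : ∀ βW ∈ Icc (0 : ℝ) (9 / 25), μ βW ∈ ymGibbsMeasures (d := 4) (fundamentalRep (Fin 2)) (2 * (βW / 4)))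
    {x : Literature.Probability.LatticeModels.Site 4} (w : (zdGraph 4).Walk x x)
    {x₀ : Literature.Probability.LatticeModels.Site 4} {D : ℕ} (hD : ∀ e ∈ walkEdges w, ‖e.1 - x₀‖ ≤ D)
    {βW : ℝ} (hb : βW ∈ Ioo (0 : ℝ) (9 / 25)) :
    HasDerivAt (fun t => ∫ U, loopTerm (d := 4) 2 1 w U ∂(μ t))
      (∑' q : ZdPlaquette 4, cov[loopTerm (d := 4) 2 1 w,
        zdPlaquetteObs (fundamentalRep (Fin 2)) q.1 q.2.1.1 q.2.1.2; μ βW]) βW :=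
  su2_hasDerivAt_integral_9_25 hμ (isLipschitzCylinder_loopTerm (N := 2) 1 w) hD hb

/-- ★ **Wilson loops are Lipschitz in the coupling on the whole star window** (`SU(2)`, `d = 4`, hypothesis-free): for all
`0 ≤ β_W, β'_W ≤ 9/25`, the DLR states `μ`, `ν`, and every closed walk `γ` (links within `D` of `x₀`):
`|⟨W_γ⟩_μ − ⟨W_γ⟩_ν| ≤ D₄·4(2√2)² e^{κ(D+3)}·(#links(γ)·√2|γ|)·128·((1+r)/(1−r))⁴·|β_W − β'_W|`, `κ = starRate(R_G(9/25))`,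
`r = e^{−κ/4}`. [folklore] -/
theorem su2_abs_loop_sub_loop_le_9_25
    {βW βW' : ℝ} (h0 : 0 ≤ βW) (hβ : βW ≤ 9 / 25) (h0' : 0 ≤ βW') (hβ' : βW' ≤ 9 / 25)
    {μ ν : Measure (LGConfig 4 (Matrix.specialUnitaryGroup (Fin 2) ℂ))}
    (hμ : μ ∈ ymGibbsMeasures (d := 4) (fundamentalRep (Fin 2)) (2 * (βW / 4)))
    (hν : ν ∈ ymGibbsMeasures (d := 4) (fundamentalRep (Fin 2)) (2 * (βW' / 4)))
    {x : Literature.Probability.LatticeModels.Site 4} (w : (zdGraph 4).Walk x x)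
    {x₀ : Literature.Probability.LatticeModels.Site 4} {D : ℕ} (hD : ∀ e ∈ walkEdges w, ‖e.1 - x₀‖ ≤ D) :
    |(∫ U, loopTerm (d := 4) 2 1 w U ∂μ) - ∫ U, loopTerm (d := 4) 2 1 w U ∂ν| ≤
      numOrient 4 * (4 * (2 * Real.sqrt 2) ^ 2 * Real.exp (starRate (gaugeR (9 / 25)) * (D + 3)) *
        (((walkEdges w).card : ℝ) * ((⟨|(1 : ℝ)| * Real.sqrt (2 : ℕ) * w.length, by positivity⟩ : ℝ≥0) : ℝ)) * 128 *
        ((1 + Real.exp (-(starRate (gaugeR (9 / 25)) / 4))) / (1 - Real.exp (-(starRate (gaugeR (9 / 25)) / 4)))) ^ 4) *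
        |βW - βW'| :=
  su2_abs_integral_sub_integral_le_9_25 h0 hβ h0' hβ' hμ hν (isLipschitzCylinder_loopTerm (N := 2) 1 w) hD

/-- ★ **Wilson loops are `C¹` in the coupling, every `SU(N)`, `N ≥ 2`, `d = 4`, hypothesis-free**: along any DLR selection on
`[0, N·9/308]`, for every closed walk `γ` and every `0 < b < N·9/308`:
`d/db ⟨W_γ⟩_{μ b} = N · Σ_q Cov_{μ b}(W_γ, W_q)` (`W = (1/N) Re tr`). [folklore] -/
theorem hasDerivAt_loop_SU_thooft (hN : 2 ≤ N)
    {μ : ℝ → Measure (LGConfig 4 (Matrix.specialUnitaryGroup (Fin N) ℂ))}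
    (hμ : ∀ b ∈ Icc (0 : ℝ) ((N : ℝ) * (9 / 308)), μ b ∈ ymGibbsMeasures (d := 4) (fundamentalRep (Fin N)) b)
    {x : Literature.Probability.LatticeModels.Site 4} (w : (zdGraph 4).Walk x x)
    {x₀ : Literature.Probability.LatticeModels.Site 4} {D : ℕ} (hD : ∀ e ∈ walkEdges w, ‖e.1 - x₀‖ ≤ D)
    {b : ℝ} (hb : b ∈ Ioo (0 : ℝ) ((N : ℝ) * (9 / 308))) :
    HasDerivAt (fun t => ∫ U, loopTerm (d := 4) N 1 w U ∂(μ t))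
      ((N : ℝ) * ∑' q : ZdPlaquette 4, cov[loopTerm (d := 4) N 1 w,
        zdPlaquetteObs (fundamentalRep (Fin N)) q.1 q.2.1.1 q.2.1.2; μ b]) b :=
  hasDerivAt_integral_SU_thooft hN hμ (isLipschitzCylinder_loopTerm (N := N) 1 w) hD hb

/-- ★ **Wilson loops are `C¹` in the coupling, every `SU(N)`, `N ≥ 2`, EVERY DIMENSION `d ≥ 2`, hypothesis-free**: along any
DLR selection on `[0, N/(12(d−1))]`, for every closed walk `γ` of `ℤ^d` and every `0 < b < N/(12(d−1))`:
`d/db ⟨W_γ⟩_{μ b} = N · Σ_q Cov_{μ b}(W_γ, W_q)`. [folklore] -/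
theorem hasDerivAt_loop_dim_thooft (hd : 2 ≤ d) (hN : 2 ≤ N)
    {μ : ℝ → Measure (LGConfig d (Matrix.specialUnitaryGroup (Fin N) ℂ))}
    (hμ : ∀ b ∈ Icc (0 : ℝ) ((N : ℝ) / (12 * ((d : ℝ) - 1))), μ b ∈ ymGibbsMeasures (d := d) (fundamentalRep (Fin N)) b)
    {x : Literature.Probability.LatticeModels.Site d} (w : (zdGraph d).Walk x x)
    {x₀ : Literature.Probability.LatticeModels.Site d} {D : ℕ} (hD : ∀ e ∈ walkEdges w, ‖e.1 - x₀‖ ≤ D)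
    {b : ℝ} (hb : b ∈ Ioo (0 : ℝ) ((N : ℝ) / (12 * ((d : ℝ) - 1)))) :
    HasDerivAt (fun t => ∫ U, loopTerm (d := d) N 1 w U ∂(μ t))
      ((N : ℝ) * ∑' q : ZdPlaquette d, cov[loopTerm (d := d) N 1 w,
        zdPlaquetteObs (fundamentalRep (Fin N)) q.1 q.2.1.1 q.2.1.2; μ b]) b :=
  hasDerivAt_integral_dim_thooft hd hN hμ (isLipschitzCylinder_loopTerm (N := N) 1 w) hD hb

end Summit.Ventures.YMGap.CouplingResponse

end
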